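import Summits.BirchSwinnertonDyer.BirchSwinnertonDyer.Theorems.ManinLocalTwoThreeLigozatIdentitiesThirtySix
import Summits.BirchSwinnertonDyer.Rank1Residual.Additive.IntModelConductorCertificate
import HarnessLib

/-!
# Level 36: the conductor of `36a1 : y² = x³ + 1` is `36` (kernel Tate certificates), and the `X₀(36)`-domain of C2/C3
# is inhabited under modularity / modulo one coefficient identity

Cell bsd-f2-manin, route `ManinLocalTwoThree` (C2 `ManinOddAtFour` stmt-22967: `4 ∣ 36`; C3 `ManinPrimeToThreeAtNine`
stmt-22968: `9 ∣ 36`), prover seat p2 gen 26; companion of `LigozatIdentitiesThirtySix.abs_maninConstant_eq_one_thirtySix`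
(FACT-FREE `|c| = 1` for every lattice-optimal `X₀(36)`-datum of every globally minimal curve).  This file records what
is kernel-provable about the DOMAIN of that `∀` (the level-`36` twin of p3's `NonVacuityTwentySeven` §1/§3 and
`LevelTwentySeven`):

* §1 **`N(36a1) = 36`** for `y² = x³ + 1` (`[0, 0, 0, 0, 1]`, `Δ = −2⁴3³`, `c₄ = 0`, `c₆ = −2⁵3³`) with NO named fact, by
  the rank-2 observatory's kernel Tate certificates (`IntModelCond.conductorNorm_mk_eq_of_certs_of_eq`): at `2` the
  translate `y ↦ y + 1` gives `[0, 0, 2, 0, 0]`, Step-5 exit (`2³ ∤ b₆ = 4`): Kodaira `IV`, `f₂ = 4 + 1 − 3 = 2`; at `3` the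
  translate `x ↦ x − 1` gives `[0, −3, 0, 3, 0]`, Step-4 exit (`3³ ∤ b₈ = −9`): Kodaira `III`, `f₃ = 3 + 1 − 2 = 2`; global
  minimality and ellipticity of the literal model; `2² ∣ 36`, `3² ∣ 36`.
* §2 GIVEN THE ITEMS' OWN BINDER `exists_isNewformOf` (modularity, printed, statement-only): `36a1` has a newform in
  `S₂(Γ₀(36))`, hence an `X₀(36)`-datum (Literature's fact-free package), hence a LATTICE-OPTIMAL datum on a global minimal
  model in the class `36a` (p2 g24's unconditional EXO) — **the `∀`-domains of C2 and C3 at `N = 36` are inhabited relative to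
  the items' hypotheses**, and by `abs_maninConstant_eq_one_thirtySix` every such datum has `|c| = 1`, `2 ∤ c`, `3 ∤ c`.
* §3 FACT-FREE REDUCTION: an `X₀(36)`-datum of some elliptic `W` exists IFF `aₙ(η(6τ)⁴) = aₙ(W)` for all `n` for some elliptic
  `W` (`nonempty_datum_thirtySix_iff`); that identity for ANY elliptic `W` yields a lattice-optimal datum on a global minimal
  model at level `36`.  The identity for `W = 36a1` (the CM newform of the Größencharakter `𝔞 ↦ (4/𝔞)₃ ϖ_𝔞` of `ℚ(ω)` of
  conductor `2λ`) is NOT proved here; under `exists_isNewformOf` it holds (`…_of_modularity`).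

HONEST FRAMING: §1 and §3 unconditional; §2 and the last theorem of §3 CONDITIONAL on `exists_isNewformOf` only.  Nothing here
proves C2, C3, Manin's conjecture or BSD; the items stay OPEN as filed.  No definition, no named fact, no sorry.
[cite: Silverman1994, IV.9.4 (Tate's algorithm, Steps 4–5) and IV.11.1] [cite: CremonaAlgorithms1997, Table 1 (36a1), Table 3]
[cite: DiamondShurman2005, Def. 8.8.2, Thm. 8.8.3] [cite: EdixhovenManin1991, Prop. 2] [cite: IrelandRosen1990, Ch. 18 §7]
-/

set_option autoImplicit false
-- lint-debt: the directory name repeats the summit name (sibling precedent `ManinLocalTwoThreeConductorTwentySeven.lean`)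
set_option linter.dupNamespace false

noncomputable section

open scoped MatrixGroups ModularForm
open WeierstrassCurve CongruenceSubgroup
open Summit.BirchSwinnertonDyer.BirchSwinnertonDyer.Rank2Observatory
open Summit.BirchSwinnertonDyer.BirchSwinnertonDyer.Rank2Observatory.RootNumber
open Summit.BirchSwinnertonDyer.BirchSwinnertonDyer.Rank2Observatory.Tate
open Summit.BirchSwinnertonDyer.Rank1Residual.Additive
open Literature.NumberTheory.EllipticCurves Literature.NumberTheory.EllipticCurves.ModularForms
open Literature.NumberTheory.Automorphic

namespace Summit.BirchSwinnertonDyer.BirchSwinnertonDyer.Theorems.ManinLocalTwoThree.NonVacuityThirtySix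

/-! ## §1 `36a1 : y² = x³ + 1` has conductor `36` — kernel Tate certificates at `2` and `3` -/

/-- The literal `ℚ`-model `[0, 0, 0, 0, 1]` read through integer casts (the currency of the certificate lemma). [folklore] -/
theorem mk_thirtySixA1_eq_cast :
    (⟨0, 0, 0, 0, 1⟩ : WeierstrassCurve ℚ) = ⟨((0 : ℤ) : ℚ), ((0 : ℤ) : ℚ), ((0 : ℤ) : ℚ), ((0 : ℤ) : ℚ), ((1 : ℤ) : ℚ)⟩ := by
  ext <;> norm_num

/-- **`N(36a1) = 36 = 2²3²`** (`y² = x³ + 1`, `Δ = −432 = −2⁴3³`): Tate certificate at `2` = translation `(r, s, t) = (0, 0, 1)` to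
`y² + 2y = x³`, Step-5 exit (`4 ∣ a₆ = 0`, `8 ∣ b₈ = 0`, `2² ∥ b₆ = 4`): Kodaira type `IV`, `f₂ = v₂(Δ) − 2 = 2`; at `3` = translation
`(r, s, t) = (−1, 0, 0)` to `y² = x³ − 3x² + 3x`, Step-4 exit (`9 ∣ a₆ = 0`, `3² ∥ b₈ = −9`): type `III`, `f₃ = v₃(Δ) − 1 = 2`.  NO named fact.
[cite: Silverman1994, IV.9.4 Steps 4–5 and IV.11.1] [cite: CremonaAlgorithms1997, Table 1 (36a1)] -/
theorem conductorNorm_thirtySixA1 : (⟨0, 0, 0, 0, 1⟩ : WeierstrassCurve ℚ).conductorNorm ℤ = 36 := by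
  rw [mk_thirtySixA1_eq_cast]
  exact IntModelCond.conductorNorm_mk_eq_of_certs_of_eq 0 0 0 0 1
    (cm := ⟨4, 0, 5, [⟨3, 1, 3, 2, 0⟩]⟩) (c := ⟨4, 0, 5, 3, 0, 3, []⟩)
    (l₂ := ⟨2, 0, 0, 1, 4, 4, 2⟩) (l₃ := ⟨2, -1, 0, 0, 3, 3, 2⟩)
    (by decide +kernel) (by decide +kernel) (by decide +kernel) (by decide +kernel) (by decide +kernel)

/-- `[0, 0, 0, 0, 1]` is a globally minimal model (`v₂(Δ) = 4`, `v₃(Δ) = 3`, both `< 12`, no other bad prime).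
[cite: SilvermanAEC2009, VII.1 Remark 1.1] -/
theorem isGloballyMinimal_thirtySixA1 : (⟨0, 0, 0, 0, 1⟩ : WeierstrassCurve ℚ).IsGloballyMinimal := by
  rw [mk_thirtySixA1_eq_cast]
  exact IntModelCond.isGloballyMinimal_mk_of_minCheck 0 0 0 0 1 (cm := ⟨4, 0, 5, [⟨3, 1, 3, 2, 0⟩]⟩) (by decide +kernel)

/-- `[0, 0, 0, 0, 1]` is an elliptic curve (`Δ = −432 ≠ 0`); a theorem, not a global instance (use `haveI`). [folklore] -/
theorem isElliptic_thirtySixA1 : (⟨0, 0, 0, 0, 1⟩ : WeierstrassCurve ℚ).IsElliptic :=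
  ⟨by norm_num [WeierstrassCurve.Δ, WeierstrassCurve.b₂, WeierstrassCurve.b₄, WeierstrassCurve.b₆, WeierstrassCurve.b₈]⟩

/-- `36 ≠ 0` as a `NeZero` fact (use `haveI`). [folklore] -/
theorem neZero_thirtySix : NeZero (36 : ℕ) := ⟨by decide⟩

/-- `2² ∣ 36`: the level `36` lies in C2's `4 ∣ N` world. [folklore] -/
theorem two_sq_dvd_thirtySix : 2 ^ 2 ∣ 36 := ⟨9, by norm_num⟩

/-- `3² ∣ 36`: the level `36` lies in C3's `9 ∣ N` world. [folklore] -/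
theorem three_sq_dvd_thirtySix : 3 ^ 2 ∣ 36 := ⟨4, by norm_num⟩

/-- `2² ∣ N(36a1)` and `3² ∣ N(36a1)`: `y² = x³ + 1` is additive at both `2` and `3`. [cite: CremonaAlgorithms1997, Table 1 (36a1)] -/
theorem sq_dvd_conductorNorm_thirtySixA1 :
    (2 : ℕ) ^ 2 ∣ (⟨0, 0, 0, 0, 1⟩ : WeierstrassCurve ℚ).conductorNorm ℤ ∧
      (3 : ℕ) ^ 2 ∣ (⟨0, 0, 0, 0, 1⟩ : WeierstrassCurve ℚ).conductorNorm ℤ := by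
  rw [conductorNorm_thirtySixA1]; exact ⟨two_sq_dvd_thirtySix, three_sq_dvd_thirtySix⟩

/-! ## §2 The `∀`-domains of C2 and C3 at `N = 36` are inhabited, GIVEN `exists_isNewformOf` -/

/-- **Modularity at `36a1`, levelled**: under `exists_isNewformOf` the curve `y² = x³ + 1` has a newform in `S₂(Γ₀(36))` (its conductor
IS `36`, §1).  CONDITIONAL on modularity. [cite: DiamondShurman2005, Thm. 8.8.3] -/
theorem exists_isNewformOf_thirtySixA1 (hnf : exists_isNewformOf) :
    ∃ f : CuspForm (Gamma0 36) 2, IsNewformOf (⟨0, 0, 0, 0, 1⟩ : WeierstrassCurve ℚ) f := by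
  haveI := isElliptic_thirtySixA1
  have key : ∀ (N : ℕ) [NeZero N], (⟨0, 0, 0, 0, 1⟩ : WeierstrassCurve ℚ).conductorNorm ℤ = N →
      ∃ f : CuspForm (Gamma0 N) 2, IsNewformOf (⟨0, 0, 0, 0, 1⟩ : WeierstrassCurve ℚ) f := by
    intro N _ hN
    subst hN
    exact hnf _
  haveI : NeZero (36 : ℕ) := ⟨by decide⟩
  exact key 36 conductorNorm_thirtySixA1

/-- Under modularity the newform of `36a1` IS `η(6τ)⁴`, i.e. **`aₙ(η(6τ)⁴) = aₙ(y² = x³ + 1)` for all `n`** (the newform of `36a1` is a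
newform of level `36`, hence `φ₃₆` by `NewformThirtySix.eq_etaProductThirtySix_of_isNewform0`).  CONDITIONAL on `exists_isNewformOf`; the
fact-free proof (the CM theta series of `ℚ(ω)` of conductor `2λ`) is not in this file. [cite: IrelandRosen1990, Ch. 18 §7] [cite: Koehler2011, §1] -/
theorem cuspCoeff_etaProductThirtySix_eq_lFunction_thirtySixA1_of_modularity (hnf : exists_isNewformOf) (n : ℕ) :
    cuspCoeff cuspFormEtaProductThirtySix n = ((⟨0, 0, 0, 0, 1⟩ : WeierstrassCurve ℚ).LFunction n : ℂ) := by
  obtain ⟨f, hf⟩ := exists_isNewformOf_thirtySixA1 hnf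
  rw [← NewformThirtySix.eq_etaProductThirtySix_of_isNewform0 hf.1]
  exact hf.2 n

/-- **A lattice-optimal `X₀(36)`-datum on a global minimal model in the class `36a` exists under modularity** (Literature's fact-free datum
package + p2 g24's unconditional EXO).  CONDITIONAL on `exists_isNewformOf` only. [cite: EdixhovenManin1991, Prop. 2] [cite: DiamondShurman2005, Thm. 8.8.3] -/
theorem exists_latticeOptimalDatum_thirtySix_of_modularity (hnf : exists_isNewformOf) :
    ∃ (W₀ : WeierstrassCurve ℚ) (_ : W₀.IsElliptic) (_ : W₀.IsGloballyMinimal) (D₀ : ModularParametrizationData W₀ 36),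
      (⟨0, 0, 0, 0, 1⟩ : WeierstrassCurve ℚ).IsIsogenous W₀ ∧ ∀ z ∈ D₀.L.lattice, ∃ w ∈ periodLattice D₀.f, z = D₀.c * w := by
  haveI := isElliptic_thirtySixA1
  haveI : NeZero (36 : ℕ) := ⟨by decide⟩
  obtain ⟨f, hf⟩ := exists_isNewformOf_thirtySixA1 hnf
  obtain ⟨D⟩ := nonempty_modularParametrizationData_of_isNewformOf hf
  obtain ⟨W₀, h₀, hmin, D₀, -, hiso, hopt, -⟩ :=
    ExistsMinimalOptimalDatum.existsMinimalOptimalDatum_full (⟨0, 0, 0, 0, 1⟩ : WeierstrassCurve ℚ) D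
  exact ⟨W₀, h₀, hmin, D₀, hiso, hopt⟩

/-- **C2's AND C3's ∀-domains are inhabited at `N = 36`, given the items' own binder `exists_isNewformOf`** — literally the binder block
(globally minimal `W₀`, `X₀(N)`-datum with the lattice clause, `2² ∣ N`, `3² ∣ N`) at `N = 36`, AND every such datum has `|c| = 1`, `2 ∤ c`,
`3 ∤ c` unconditionally (`LigozatIdentitiesThirtySix`).  CONDITIONAL on `exists_isNewformOf` for the existence half only.
[cite: DiamondShurman2005, Thm. 8.8.3] [cite: EdixhovenManin1991, Prop. 2] -/
theorem maninLocalTwoThree_domain_inhabited_thirtySix_of_modularity (hnf : exists_isNewformOf) :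
    (∃ (W₀ : WeierstrassCurve ℚ) (_ : W₀.IsElliptic) (_ : W₀.IsGloballyMinimal) (D₀ : ModularParametrizationData W₀ 36),
      (∀ z ∈ D₀.L.lattice, ∃ w ∈ periodLattice D₀.f, z = D₀.c * w) ∧ 2 ^ 2 ∣ 36 ∧ 3 ^ 2 ∣ 36) ∧
    ∀ (W : WeierstrassCurve ℚ) [W.IsGloballyMinimal] (D : ModularParametrizationData W 36),
      (∀ z ∈ D.L.lattice, ∃ w ∈ periodLattice D.f, z = D.c * w) →
        |D.maninConstant| = 1 ∧ ¬ (2 : ℤ) ∣ D.maninConstant ∧ ¬ (3 : ℤ) ∣ D.maninConstant := by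
  refine ⟨?_, fun W _ D hopt ↦ ⟨LigozatIdentitiesThirtySix.abs_maninConstant_eq_one_thirtySix W D hopt,
    LigozatIdentitiesThirtySix.not_two_dvd_maninConstant_thirtySix W D hopt,
    LigozatIdentitiesThirtySix.not_three_dvd_maninConstant_thirtySix W D hopt⟩⟩
  obtain ⟨W₀, h₀, hmin, D₀, -, hopt⟩ := exists_latticeOptimalDatum_thirtySix_of_modularity hnf
  exact ⟨W₀, h₀, hmin, D₀, hopt, two_sq_dvd_thirtySix, three_sq_dvd_thirtySix⟩

/-! ## §3 The one-identity reduction: a fact-free `N = 36` witness ⟺ `aₙ(η(6τ)⁴) = aₙ(W)` for some elliptic `W` -/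

/-- **`IsNewformOf W φ₃₆` from the coefficient identity alone** (newness, eigen-ness and `a₁ = 1` are `NewformThirtySix`).
[cite: DiamondShurman2005, Def. 8.8.2] -/
theorem isNewformOf_etaProductThirtySix_of_cuspCoeff_eq {W : WeierstrassCurve ℚ}
    (h : ∀ n : ℕ, cuspCoeff cuspFormEtaProductThirtySix n = (W.LFunction n : ℂ)) : IsNewformOf W cuspFormEtaProductThirtySix :=
  ⟨NewformThirtySix.isNewform0_etaProductThirtySix, h⟩

/-- **A fact-free lattice-optimal `X₀(36)`-datum on a global minimal model — with `|c| = 1` — MODULO the identity `aₙ(η(6τ)⁴) = aₙ(W)`** for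
one elliptic `W` (e.g. `W = 36a1`): identity ⟹ `IsNewformOf` ⟹ datum (Literature package) ⟹ lattice-optimal minimal twin (EXO) ⟹ `|c| = 1`
(`LigozatIdentitiesThirtySix`).  UNCONDITIONAL implication. [cite: EdixhovenManin1991, Prop. 2] [cite: DiamondShurman2005, Def. 8.8.2] -/
theorem exists_latticeOptimalDatum_thirtySix_of_cuspCoeff_eq (W : WeierstrassCurve ℚ) [W.IsElliptic]
    (h : ∀ n : ℕ, cuspCoeff cuspFormEtaProductThirtySix n = (W.LFunction n : ℂ)) :
    ∃ (W₀ : WeierstrassCurve ℚ) (_ : W₀.IsElliptic) (_ : W₀.IsGloballyMinimal) (D₀ : ModularParametrizationData W₀ 36),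
      D₀.f = cuspFormEtaProductThirtySix ∧ W.IsIsogenous W₀ ∧
        (∀ z ∈ D₀.L.lattice, ∃ w ∈ periodLattice D₀.f, z = D₀.c * w) ∧ |D₀.maninConstant| = 1 := by
  haveI : NeZero (36 : ℕ) := ⟨by decide⟩
  obtain ⟨D⟩ := nonempty_modularParametrizationData_of_isNewformOf (isNewformOf_etaProductThirtySix_of_cuspCoeff_eq h)
  obtain ⟨W₀, h₀, hmin, D₀, -, hiso, hopt, -⟩ := ExistsMinimalOptimalDatum.existsMinimalOptimalDatum_full W D
  exact ⟨W₀, h₀, hmin, D₀, NewformThirtySix.f_eq_etaProductThirtySix D₀, hiso, hopt,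
    LigozatIdentitiesThirtySix.abs_maninConstant_eq_one_thirtySix W₀ D₀ hopt⟩

/-- **The reduction is EXACT**: an `X₀(36)`-datum of some elliptic curve exists IFF the coefficients of `η(6τ)⁴` are the `L`-coefficients of
some elliptic curve over `ℚ`.  FACT-FREE. [cite: DiamondShurman2005, Def. 8.8.2] [cite: EdixhovenManin1991, Prop. 2] -/
theorem nonempty_datum_thirtySix_iff :
    (∃ (W : WeierstrassCurve ℚ) (_ : W.IsElliptic), Nonempty (ModularParametrizationData W 36)) ↔
      ∃ (W : WeierstrassCurve ℚ) (_ : W.IsElliptic), ∀ n : ℕ, cuspCoeff cuspFormEtaProductThirtySix n = (W.LFunction n : ℂ) := by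
  haveI : NeZero (36 : ℕ) := ⟨by decide⟩
  constructor
  · rintro ⟨W, hW, ⟨D⟩⟩
    refine ⟨W, hW, fun n ↦ ?_⟩
    rw [← NewformThirtySix.f_eq_etaProductThirtySix D]
    exact D.isNewformOf.2 n
  · rintro ⟨W, hW, h⟩
    exact ⟨W, hW, nonempty_modularParametrizationData_of_isNewformOf (isNewformOf_etaProductThirtySix_of_cuspCoeff_eq h)⟩

end Summit.BirchSwinnertonDyer.BirchSwinnertonDyer.Theorems.ManinLocalTwoThree.NonVacuityThirtySix

end
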